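import Literature.AlgebraicGeometry.Motives.SeesawChartSections
import Literature.AlgebraicGeometry.Modules.Biduality
import Literature.AlgebraicGeometry.Modules.DualSectionsEquiv
import Literature.AlgebraicGeometry.Modules.LineBundleUnitPairing
import Literature.AlgebraicGeometry.Modules.AffineLocalizingClosure
import Literature.AlgebraicGeometry.Modules.QuasicoherentAbelian
import HarnessLib

/-!
# The seesaw closed subscheme, chart step: the fibres — sections over a field form a line, the empty fibre, base change of the pairing

[MumfordAV1970] §10 (p. 89), the three per-chart inputs of the seesaw theorem in scheme form ([GortzWedhorn2023] Thm. 24.66)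
that concern single test algebras, in the vocabulary of `SeesawChartSections` (`X/ℂ` proper geometrically integral,
`𝓕` of rank one on `X × W`, affine `U ⊆ W`):
* §1–§2 (author B-p04 (g15), HOME `N1s-TrivOfSubsingleton.v1` a511f1ef): modules on a scheme WITHOUT POINTS are all isomorphic;
  for the zero ring `B`, `X × Spec B = ∅`, so `𝓕_B` is trivialised from the base (`trivOfSubsingleton`);
* §3–§4 (author B-p04 (g15), HOME `N1s-FibreDimLeOne.v2` 75ae2977): a functional killing no non-zero section makes the
  sections a LINE over the constants (`finrank_eq_one_of_forall_ne_zero`, generic); on the integral proper fibre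
  `X × Spec K` (`K` a field) a non-zero section and a non-zero functional pair to a non-zero constant
  (★ `appLE_ne_zero_of_ne_zero`, Hartshorne II 6.15), so `H⁰(X_K, 𝓕_K)` and `Hom(𝓕_K|_⊤, 𝒪|_⊤)` are lines as soon as
  the other side is non-zero (`h0_cyclic_of_dualSec_ne_zero`, `dualSec_cyclic_of_h0_ne_zero`);
* §5 (author B-p04 (g15), HOME `N1h-BrickNHolds.v1` cd1c15d2, over B-typ03 (g12)'s ★ `Modules.DualSectionsEquiv`):
  **`evalPair_baseChange`** — the evaluation pairing commutes with base change, `μ_C(σ_C) = (1 × Spec φ)♯(μ_B(σ_B))`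
  ([Hartshorne1977] II Ex. 5.1 (d)).
Decls token-identical to the HOME bytes except that the hypothesis `brickB` is discharged by the ★ name
(cell `hodgecm-mathlib`, M13 node N1, file S4b of the split plan; PROOF lane).

## References
* [MumfordAV1970] D. Mumford, *Abelian Varieties* (1970), §10 p. 89.
* [Hartshorne1977] R. Hartshorne, *Algebraic Geometry* (1977), II Prop. 6.15, II Ex. 5.1 (b), (d).
* [GortzWedhorn2020] U. Görtz, T. Wedhorn, *Algebraic Geometry I* (2020), Prop. 5.51.
* [GortzWedhorn2023] U. Görtz, T. Wedhorn, *Algebraic Geometry II* (2023), Thm. 24.66 (p. 405; proof pp. 407–408).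
-/

set_option autoImplicit false

noncomputable section

-- `TopCat.Presheaf`/`Scheme.Modules` are not reducible (as in Mathlib's `AlgebraicGeometry/Modules`).
set_option backward.isDefEq.respectTransparency false

universe u v

open CategoryTheory CategoryTheory.Limits AlgebraicGeometry MonoidalCategory CartesianMonoidalCategory
  Opposite TopologicalSpace


namespace Literature.AlgebraicGeometry.Modules

/-! ## §1 Modules on a scheme without points -/

/-- On a scheme without points every open is `⊥`. [cite: MumfordAV1970, §10 (p. 89)] -/
theorem Scheme.opens_eq_bot_of_isEmpty {Y : Scheme.{u}} [IsEmpty Y] (W : Y.Opens) : W = ⊥ :=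
  le_bot_iff.mp fun y _ => isEmptyElim y

/-- A sheaf of modules has only the zero section over an empty open (the empty component of a sheaf is
terminal; Hartshorne builds `𝓕(∅) = 0` into the definition of a presheaf).
[cite: Hartshorne1977, II §1 Definition (presheaf), p. 61] -/
theorem sections_eq_zero_of_opens_eq_bot {Y : Scheme.{u}} (M : Y.Modules) {W : Y.Opens} (hW : W = ⊥)
    (s : Γ(M, W)) : s = 0 :=
  haveI : Subsingleton Γ(M, W) := AddCommGrpCat.subsingleton_of_isZero
    ((TopCat.Sheaf.isTerminalOfEqEmpty (⟨M.presheaf, Scheme.Modules.isSheaf M⟩ : TopCat.Sheaf Ab Y) hW).isZero)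
  Subsingleton.elim _ _

/-- **Every `𝒪_Y`-module on a scheme without points is a zero object.**
[cite: Hartshorne1977, II §1 Definition (presheaf), p. 61] -/
theorem isZero_of_isEmpty {Y : Scheme.{u}} [IsEmpty Y] (M : Y.Modules) : IsZero M := by
  rw [IsZero.iff_id_eq_zero]
  refine Scheme.Modules.hom_ext _ _ fun W => ?_
  ext y
  rw [sections_eq_zero_of_opens_eq_bot M (Scheme.opens_eq_bot_of_isEmpty W) y, map_zero, map_zero]

/-- Any two `𝒪_Y`-modules on a scheme without points are isomorphic. [cite: MumfordAV1970, §10 (p. 89)] -/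
theorem nonempty_iso_of_isEmpty {Y : Scheme.{u}} [IsEmpty Y] (M N : Y.Modules) : Nonempty (M ≅ N) :=
  ⟨(isZero_of_isEmpty M).iso (isZero_of_isEmpty N)⟩

/-- A scheme mapping to a scheme without points has no points. [cite: MumfordAV1970, §10 (p. 89)] -/
theorem Scheme.isEmpty_of_hom {Y Z : Scheme.{u}} (f : Y ⟶ Z) [IsEmpty Z] : IsEmpty Y :=
  Function.isEmpty f.base

/-- `Spec B = ∅` for the zero ring `B`. [cite: Hartshorne1977, II Prop. 2.3 language (p. 70)] -/
theorem Scheme.isEmpty_Spec_of_subsingleton (B : Type u) [CommRing B] [Subsingleton B] :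
    IsEmpty (Spec (.of B) : Scheme.{u}) :=
  PrimeSpectrum.isEmpty_iff_subsingleton.2 ‹_›

end Literature.AlgebraicGeometry.Modules

namespace Literature.AlgebraicGeometry.Motives

namespace SeesawSubscheme

open Literature.AlgebraicGeometry.Modules

variable (X : SchemeOver ℂ) {W : SchemeOver ℂ} (𝓕 : (X ⊗ W).left.Modules) (U : W.left.affineOpens)

/-! ## §2 The zero ring: `X × Spec 0 = ∅` is trivialised from the base -/

/-- **`X × Spec B` has no points for the zero ring `B`.** [cite: MumfordAV1970, §10 (p. 89)] -/
theorem isEmpty_tensor_specTest (B : Type) [CommRing B] [Algebra Γ(W.left, U) B] [Subsingleton B] :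
    IsEmpty (X ⊗ specTest U B).left :=
  haveI : IsEmpty (specTest U B).left := Scheme.isEmpty_Spec_of_subsingleton B
  Scheme.isEmpty_of_hom (CartesianMonoidalCategory.snd X (specTest U B)).left

/-- **The zero ring** (half-empty charts of the seesaw locus): for the zero ring `B`,
`𝓕_B` is trivialised from the base — `X × Spec B = ∅`, so `𝓕_B ≅ pr^*𝒪_{Spec B}` as two modules on a
scheme without points, with `𝒪_{Spec B}` quasi-coherent of rank one. [cite: MumfordAV1970, §10 (p. 89)] -/
theorem trivOfSubsingleton (B : Type) [CommRing B] [Algebra Γ(W.left, U) B] [Subsingleton B] :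
    Triv X 𝓕 U B := by
  haveI : IsEmpty (X ⊗ specTest U B).left := isEmpty_tensor_specTest X U B
  haveI : (unitModule (specTest U B).left).IsQuasicoherent :=
    isQuasicoherent_of_isAffineLocalizing IsAffineLocalizing.unit
  exact ⟨unitModule (specTest U B).left, inferInstance, hasRank_unitModule,
    nonempty_iso_of_isEmpty _ _⟩

end SeesawSubscheme

end Literature.AlgebraicGeometry.Motives

namespace Literature.AlgebraicGeometry.Modules

open Literature.AlgebraicGeometry.Motives

/-! ## §3 A functional with no non-zero isotropic section makes `Γ(E)` a line -/

variable {Y : Scheme.{u}} {E : Y.Modules}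

/-- **Evaluation against `μ` is injective** when `μ(σ) ≠ 0` for all `σ ≠ 0` (additive with zero kernel).
[cite: Hartshorne1977, II Prop. 6.15 (proof)] -/
theorem injective_appLE_of_forall_ne_zero
    (μ : E.over (⊤ : Y.Opens) ⟶ (unitModule Y).over (⊤ : Y.Opens))
    (hμ : ∀ σ : Γ(E, (⊤ : Y.Opens)), σ ≠ 0 →
      ((appLE μ (𝟙 ⊤) σ : Γ(unitModule Y, (⊤ : Y.Opens))) : Γ(Y, (⊤ : Y.Opens))) ≠ 0) :
    Function.Injective fun σ : Γ(E, (⊤ : Y.Opens)) =>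
      ((appLE μ (𝟙 ⊤) σ : Γ(unitModule Y, (⊤ : Y.Opens))) : Γ(Y, (⊤ : Y.Opens))) := by
  intro σ τ h
  by_contra hne
  refine hμ (σ - τ) (sub_ne_zero.2 hne) ?_
  have hsub : appLE μ (𝟙 ⊤) (σ - τ) = appLE μ (𝟙 ⊤) σ - appLE μ (𝟙 ⊤) τ :=
    map_sub (μ.val.app (op (Over.mk (𝟙 ⊤)))).hom σ τ
  change ((appLE μ (𝟙 ⊤) σ : Γ(unitModule Y, (⊤ : Y.Opens))) : Γ(Y, (⊤ : Y.Opens))) =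
    ((appLE μ (𝟙 ⊤) τ : Γ(unitModule Y, (⊤ : Y.Opens))) : Γ(Y, (⊤ : Y.Opens))) at h
  change ((appLE μ (𝟙 ⊤) (σ - τ) : Γ(unitModule Y, (⊤ : Y.Opens))) : Γ(Y, (⊤ : Y.Opens))) = 0
  rw [hsub]
  exact sub_eq_zero.2 h

/-- **`σ ↦ i⁻¹ μ(σ)` is an injective `K`-linear map `Γ(E) → K`** when `Γ(Y, 𝒪) = K` is a field through the
bijection `i` (the `K`-structure on `Γ(E)` being restriction of scalars along `i`) and `μ(σ) ≠ 0` for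
`σ ≠ 0`. [cite: MumfordAV1970, §10 (p. 89)] -/
theorem exists_injective_linearMap_of_forall_ne_zero {K : Type v} [Field K]
    (i : K →+* Γ(Y, (⊤ : Y.Opens))) (hi : Function.Bijective i)
    (μ : E.over (⊤ : Y.Opens) ⟶ (unitModule Y).over (⊤ : Y.Opens))
    (hμ : ∀ σ : Γ(E, (⊤ : Y.Opens)), σ ≠ 0 →
      ((appLE μ (𝟙 ⊤) σ : Γ(unitModule Y, (⊤ : Y.Opens))) : Γ(Y, (⊤ : Y.Opens))) ≠ 0) :
    letI : Module K Γ(E, (⊤ : Y.Opens)) := Module.compHom _ i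
    ∃ ℓ : Γ(E, (⊤ : Y.Opens)) →ₗ[K] K, Function.Injective ℓ := by
  letI : Module K Γ(E, (⊤ : Y.Opens)) := Module.compHom _ i
  let e : K ≃+* Γ(Y, (⊤ : Y.Opens)) := RingEquiv.ofBijective i hi
  let ev : Γ(E, (⊤ : Y.Opens)) → Γ(Y, (⊤ : Y.Opens)) := fun σ =>
    ((appLE μ (𝟙 ⊤) σ : Γ(unitModule Y, (⊤ : Y.Opens))) : Γ(Y, (⊤ : Y.Opens)))
  have hev_add : ∀ σ τ, ev (σ + τ) = ev σ + ev τ := fun σ τ =>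
    map_add (μ.val.app (op (Over.mk (𝟙 ⊤)))).hom σ τ
  have hev_smul : ∀ (k : K) σ, ev (k • σ) = i k * ev σ := fun k σ => by
    change ((appLE μ (𝟙 ⊤) (i k • σ) : Γ(unitModule Y, (⊤ : Y.Opens))) : Γ(Y, (⊤ : Y.Opens))) = _
    rw [appLE_smul_right]
    rfl
  refine ⟨{ toFun := fun σ => e.symm (ev σ)
            map_add' := fun σ τ => by rw [hev_add, map_add]
            map_smul' := fun k σ => by
              rw [hev_smul, map_mul, RingHom.id_apply, smul_eq_mul]
              congr 1
              exact e.symm_apply_apply k }, ?_⟩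
  intro σ τ h
  exact injective_appLE_of_forall_ne_zero μ hμ (e.symm.injective h)

/-- **`Γ(E)` is a finite `K`-space of dimension `≤ 1`** under the hypotheses of
`exists_injective_linearMap_of_forall_ne_zero`. [cite: MumfordAV1970, §10 (p. 89)] -/
theorem finite_and_finrank_le_one_of_forall_ne_zero {K : Type v} [Field K]
    (i : K →+* Γ(Y, (⊤ : Y.Opens))) (hi : Function.Bijective i)
    (μ : E.over (⊤ : Y.Opens) ⟶ (unitModule Y).over (⊤ : Y.Opens))
    (hμ : ∀ σ : Γ(E, (⊤ : Y.Opens)), σ ≠ 0 →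
      ((appLE μ (𝟙 ⊤) σ : Γ(unitModule Y, (⊤ : Y.Opens))) : Γ(Y, (⊤ : Y.Opens))) ≠ 0) :
    letI : Module K Γ(E, (⊤ : Y.Opens)) := Module.compHom _ i
    Module.Finite K Γ(E, (⊤ : Y.Opens)) ∧ Module.finrank K Γ(E, (⊤ : Y.Opens)) ≤ 1 := by
  letI : Module K Γ(E, (⊤ : Y.Opens)) := Module.compHom _ i
  obtain ⟨ℓ, hℓ⟩ := exists_injective_linearMap_of_forall_ne_zero i hi μ hμ
  haveI : Module.Finite K Γ(E, (⊤ : Y.Opens)) := Module.Finite.of_injective ℓ hℓ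
  exact ⟨inferInstance, (LinearMap.finrank_le_finrank_of_injective hℓ).trans (Module.finrank_self K).le⟩

/-- **`dim_K Γ(E) = 1`** if in addition some section is non-zero. [cite: MumfordAV1970, §10 (p. 89)] -/
theorem finrank_eq_one_of_forall_ne_zero {K : Type v} [Field K]
    (i : K →+* Γ(Y, (⊤ : Y.Opens))) (hi : Function.Bijective i)
    (μ : E.over (⊤ : Y.Opens) ⟶ (unitModule Y).over (⊤ : Y.Opens))
    (hμ : ∀ σ : Γ(E, (⊤ : Y.Opens)), σ ≠ 0 →
      ((appLE μ (𝟙 ⊤) σ : Γ(unitModule Y, (⊤ : Y.Opens))) : Γ(Y, (⊤ : Y.Opens))) ≠ 0)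
    (σ : Γ(E, (⊤ : Y.Opens))) (hσ : σ ≠ 0) :
    letI : Module K Γ(E, (⊤ : Y.Opens)) := Module.compHom _ i
    Module.finrank K Γ(E, (⊤ : Y.Opens)) = 1 := by
  letI : Module K Γ(E, (⊤ : Y.Opens)) := Module.compHom _ i
  obtain ⟨hfin, hle⟩ := finite_and_finrank_le_one_of_forall_ne_zero i hi μ hμ
  have hpos : 0 < Module.finrank K Γ(E, (⊤ : Y.Opens)) :=
    Module.finrank_pos_iff_exists_ne_zero.2 ⟨σ, hσ⟩
  omega


/-- **Dual side**: if `σ ∈ Γ(E)` satisfies `μ(σ) ≠ 0` for every functional `μ ≠ 0`, then `Γ(E^∨)` is a finite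
`K`-space of dimension `≤ 1` (`Γ(Y, 𝒪) = K` through the bijection `i`) — apply the previous results to `E^∨` and
the double-dual functional `ev_σ = toBidual(σ)`, whose value on `μ` is `μ(σ)` (Hartshorne II Ex. 5.1 (a)).
[cite: MumfordAV1970, §10 (p. 89)] [cite: Hartshorne1977, II Ex. 5.1 (a)] -/
theorem finite_and_finrank_dual_le_one_of_forall_ne_zero {K : Type v} [Field K]
    (i : K →+* Γ(Y, (⊤ : Y.Opens))) (hi : Function.Bijective i) (σ : Γ(E, (⊤ : Y.Opens)))
    (hσ : ∀ μ : Γ(dual E, (⊤ : Y.Opens)), μ ≠ 0 →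
      ((appLE (μ : E.over (⊤ : Y.Opens) ⟶ (unitModule Y).over (⊤ : Y.Opens)) (𝟙 ⊤) σ :
        Γ(unitModule Y, (⊤ : Y.Opens))) : Γ(Y, (⊤ : Y.Opens))) ≠ 0) :
    letI : Module K Γ(dual E, (⊤ : Y.Opens)) := Module.compHom _ i
    Module.Finite K Γ(dual E, (⊤ : Y.Opens)) ∧ Module.finrank K Γ(dual E, (⊤ : Y.Opens)) ≤ 1 := by
  refine finite_and_finrank_le_one_of_forall_ne_zero (E := dual E) i hi
    ((toBidual E (unitModule Y)).app ⊤ σ : (dual E).over (⊤ : Y.Opens) ⟶ (unitModule Y).over (⊤ : Y.Opens))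
    fun μ hμ => ?_
  rw [appLE_toBidual_app]
  exact hσ μ hμ

/-- **`dim_K Γ(E^∨) = 1`** if in addition some functional is non-zero. [cite: MumfordAV1970, §10 (p. 89)] -/
theorem finrank_dual_eq_one_of_forall_ne_zero {K : Type v} [Field K]
    (i : K →+* Γ(Y, (⊤ : Y.Opens))) (hi : Function.Bijective i) (σ : Γ(E, (⊤ : Y.Opens)))
    (hσ : ∀ μ : Γ(dual E, (⊤ : Y.Opens)), μ ≠ 0 →
      ((appLE (μ : E.over (⊤ : Y.Opens) ⟶ (unitModule Y).over (⊤ : Y.Opens)) (𝟙 ⊤) σ :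
        Γ(unitModule Y, (⊤ : Y.Opens))) : Γ(Y, (⊤ : Y.Opens))) ≠ 0)
    (μ : Γ(dual E, (⊤ : Y.Opens))) (hμ : μ ≠ 0) :
    letI : Module K Γ(dual E, (⊤ : Y.Opens)) := Module.compHom _ i
    Module.finrank K Γ(dual E, (⊤ : Y.Opens)) = 1 := by
  refine finrank_eq_one_of_forall_ne_zero (E := dual E) i hi
    ((toBidual E (unitModule Y)).app ⊤ σ : (dual E).over (⊤ : Y.Opens) ⟶ (unitModule Y).over (⊤ : Y.Opens))
    (fun ν hν => ?_) μ hμ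
  rw [appLE_toBidual_app]
  exact hσ ν hν

end Literature.AlgebraicGeometry.Modules

namespace Literature.AlgebraicGeometry.Motives

namespace SeesawSubscheme

open Literature.AlgebraicGeometry.Modules

variable (X : SchemeOver ℂ) {W : SchemeOver ℂ} (𝓕 : (X ⊗ W).left.Modules) (U : W.left.affineOpens)

variable [IsProper X.hom] [GeometricallyIntegral X.hom]

/-! ## §4 The fibres over a field: sections and functionals form lines -/

omit [IsProper X.hom] in
/-- On the integral fibre `X × Spec K`, a non-zero functional `μ ∈ Hom(𝓕_K|_⊤, 𝒪|_⊤)` kills no non-zero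
section (brick (B) on `X_K`, integral by geometric integrality of `X/ℂ`). [cite: MumfordAV1970, §10 (p. 89)] -/
theorem evalPair_ne_zero_of_ne_zero (h𝓕 : HasRank 𝓕 1) (K : Type) [Field K]
    [Algebra Γ(W.left, U) K] (μ : DualSec X 𝓕 U K) (hμ : μ ≠ 0) (σ : H0 X 𝓕 U K) (hσ : σ ≠ 0) :
    evalPair X 𝓕 U K μ σ ≠ 0 := by
  haveI : IsIntegral (X ⊗ specTest U K).left := isIntegral_tensor_specTest X U K
  exact appLE_ne_zero_of_ne_zero (hasRank_FB X 𝓕 U h𝓕 K) hσ hμ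

/-- **`dim_K H⁰(X_K, 𝓕_K) = 1`** when both `H⁰(X_K, 𝓕_K) ≠ 0` and `Hom(𝓕_K|_⊤, 𝒪|_⊤) ≠ 0` (the point lies in
`Supp Q ∩ Supp Q′`); by ★ brick (B). [cite: MumfordAV1970, §10 (p. 89)] -/
theorem finrank_h0_eq_one (h𝓕 : HasRank 𝓕 1) (K : Type) [Field K]
    [Algebra Γ(W.left, U) K] (μ : DualSec X 𝓕 U K) (hμ : μ ≠ 0) (σ : H0 X 𝓕 U K) (hσ : σ ≠ 0) :
    Module.finrank K (H0 X 𝓕 U K) = 1 :=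
  finrank_eq_one_of_forall_ne_zero (toTopRing X U K) (toTopRing_bijective X U K)
    (μ : (FB X 𝓕 U K).over ⊤ ⟶ (unitModule (X ⊗ specTest U K).left).over ⊤)
    (fun τ hτ => evalPair_ne_zero_of_ne_zero X 𝓕 U h𝓕 K μ hμ τ hτ) σ hσ

/-- **`dim_K Hom(𝓕_K|_⊤, 𝒪|_⊤) = 1`** when both a non-zero section and a non-zero functional exist; by ★ brick (B).
[cite: MumfordAV1970, §10 (p. 89)] -/
theorem finrank_dualSec_eq_one (h𝓕 : HasRank 𝓕 1) (K : Type) [Field K]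
    [Algebra Γ(W.left, U) K] (σ : H0 X 𝓕 U K) (hσ : σ ≠ 0) (μ : DualSec X 𝓕 U K) (hμ : μ ≠ 0) :
    Module.finrank K (DualSec X 𝓕 U K) = 1 :=
  finrank_dual_eq_one_of_forall_ne_zero (E := FB X 𝓕 U K) (toTopRing X U K) (toTopRing_bijective X U K) σ
    (fun ν hν => evalPair_ne_zero_of_ne_zero X 𝓕 U h𝓕 K ν hν σ hσ) μ hμ

/-- **`H⁰(X_K, 𝓕_K)` is a line through any non-zero section** as soon as `Hom(𝓕_K|_⊤, 𝒪|_⊤) ≠ 0` (first half of the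
fibre statement `fibreCyclic` of the chart step). [cite: MumfordAV1970, §10 (p. 89)] -/
theorem h0_cyclic_of_dualSec_ne_zero (h𝓕 : HasRank 𝓕 1) (K : Type) [Field K] [Algebra Γ(W.left, U) K]
    (hμ : ∃ μ : DualSec X 𝓕 U K, μ ≠ 0) (σ₁ σ₂ : H0 X 𝓕 U K) (hσ₁ : σ₁ ≠ 0) : ∃ c : K, σ₂ = c • σ₁ := by
  obtain ⟨μ, hμ⟩ := hμ
  have h1 : Module.finrank K (H0 X 𝓕 U K) = 1 := finrank_h0_eq_one X 𝓕 U h𝓕 K μ hμ σ₁ hσ₁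
  obtain ⟨c, hc⟩ := (finrank_eq_one_iff_of_nonzero' σ₁ hσ₁).1 h1 σ₂
  exact ⟨c, hc.symm⟩

/-- **`Hom(𝓕_K|_⊤, 𝒪|_⊤)` is a line through any non-zero functional** as soon as `H⁰(X_K, 𝓕_K) ≠ 0` (second half of
`fibreCyclic`). [cite: MumfordAV1970, §10 (p. 89)] -/
theorem dualSec_cyclic_of_h0_ne_zero (h𝓕 : HasRank 𝓕 1) (K : Type) [Field K] [Algebra Γ(W.left, U) K]
    (hσ : ∃ σ : H0 X 𝓕 U K, σ ≠ 0) (μ₁ μ₂ : DualSec X 𝓕 U K) (hμ₁ : μ₁ ≠ 0) : ∃ c : K, μ₂ = c • μ₁ := by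
  obtain ⟨σ, hσ⟩ := hσ
  have h1 : Module.finrank K (DualSec X 𝓕 U K) = 1 := finrank_dualSec_eq_one X 𝓕 U h𝓕 K σ hσ μ₁ hμ₁
  obtain ⟨c, hc⟩ := (finrank_eq_one_iff_of_nonzero' μ₁ hμ₁).1 h1 μ₂
  exact ⟨c, hc.symm⟩

end SeesawSubscheme

end Literature.AlgebraicGeometry.Motives

/-! ## §5 Base change of the evaluation pairing (`brickN`) over ★ `Modules.DualSectionsEquiv` -/

namespace Literature.AlgebraicGeometry.Motives

namespace SeesawSubscheme

open Literature.AlgebraicGeometry.Modules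

variable (X : SchemeOver ℂ) {W : SchemeOver ℂ} (𝓕 : (X ⊗ W).left.Modules) (U : W.left.affineOpens)



/-- **The `FBIso` cancellation**: evaluating `e⁻¹|_⊤ ≫ ν` on `e(s)` is evaluating `ν` on `s`. [cite: MumfordAV1970, §10 (p. 89)] -/
theorem appLE_sheafHomMapLeft_inv_app_hom_app {Z : Scheme.{0}} {M N : Z.Modules} (e : M ≅ N)
    (ν : M.over (⊤ : Z.Opens) ⟶ (unitModule Z).over (⊤ : Z.Opens)) (s : Γ(M, (⊤ : Z.Opens))) :
    appLE ((sheafHomMapLeft e.inv (unitModule Z)).app ⊤ ν : N.over (⊤ : Z.Opens) ⟶ (unitModule Z).over (⊤ : Z.Opens))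
      (𝟙 ⊤) (e.hom.app ⊤ s) = appLE ν (𝟙 ⊤) s := by
  rw [sheafHomMapLeft_app_apply, appLE_comp, appLE_over_map, inv_app_hom_app]

/-- **Brick (N) with an iso cancellation, generic form**: for `f : Y′ ⟶ Y`, `E` finite locally free on `Y`, an isomorphism
`e : f^*E ≅ E′`, a functional `μ : E|_⊤ ⟶ 𝒪|_⊤` and a section `σ`, the functional `e⁻¹| ≫ c_f(η_f μ)` on `E′` evaluated at
`e(η_f σ)` is `f♯_⊤(μ(σ))` — stated in the `Γ(Y′, ⊤)`/`appTop` currency of B-p01's `evalPair`/`baseChangeTop`, each sub-term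
ascribed the type at which B-p01's `H0map`/`DualSecMap`/`evalPair` bodies are elaborated (so that the socket below is this lemma up to
`δ`/`β`; B-typ03's brick (C) core + `appLE_sheafHomMapLeft_inv_app_hom_app`). [cite: Hartshorne1977, II Ex. 5.1 (d)] -/
theorem appLE_sheafHomMapLeft_pullbackDualIso_unitSection {Y' Y : Scheme.{0}} (f : Y' ⟶ Y) {E : Y.Modules}
    (hE : IsFiniteLocallyFree E) {E' : Y'.Modules} (e : (Scheme.Modules.pullback f).obj E ≅ E')
    (μ : Γ(dual E, (⊤ : Y.Opens))) (σ : Γ(E, (⊤ : Y.Opens))) :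
    @Eq Γ(Y', (⊤ : Y'.Opens))
      (appLE ((show Γ(dual E', (⊤ : Y'.Opens)) from
          ((sheafHomMapLeft e.inv (unitModule Y')).app ⊤)
            (((pullbackDualIso f hE).hom.app ⊤) (unitSection f (dual E) ⊤ μ))) :
            E'.over (⊤ : Y'.Opens) ⟶ (unitModule Y').over (⊤ : Y'.Opens)) (𝟙 ⊤)
        (show Γ(E', (⊤ : Y'.Opens)) from (e.hom.app ⊤) (unitSection f E ⊤ σ)) :
          Γ(unitModule Y', (⊤ : Y'.Opens)))
      ((f.appTop).hom
        (appLE (μ : E.over (⊤ : Y.Opens) ⟶ (unitModule Y).over (⊤ : Y.Opens)) (𝟙 ⊤) σ :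
          Γ(unitModule Y, (⊤ : Y.Opens)))) := by
  change appLE ((sheafHomMapLeft e.inv (unitModule Y')).app ⊤
      ((pullbackDualIso f hE).hom.app ⊤ (unitSection f (dual E) ⊤ μ)) :
        E'.over (⊤ : Y'.Opens) ⟶ (unitModule Y').over (⊤ : Y'.Opens)) (𝟙 ⊤)
      (e.hom.app ⊤ (unitSection f E ⊤ σ)) =
    (f.app ⊤ (appLE (μ : E.over (⊤ : Y.Opens) ⟶ (unitModule Y).over (⊤ : Y.Opens)) (𝟙 ⊤) σ :
      Γ(unitModule Y, (⊤ : Y.Opens))) : Γ(unitModule Y', f ⁻¹ᵁ ⊤))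
  rw [appLE_sheafHomMapLeft_inv_app_hom_app]
  exact appLE_pullbackDualIso_hom_app_unitSection f hE μ σ

/-- **Brick (N) holds**: the evaluation pairing commutes with base change along a chart algebra map
`φ : B → C` — `μ_C(σ_C) = (1 × Spec φ)♯(μ_B(σ_B))` ([Hartshorne1977] II Ex. 5.1 (d): `f^*` is compatible with `𝓗om`/duals;
B-typ03's brick (C) core + the `FBIso` cancellation; `H0map`/`DualSecMap`/`evalPair` are unfolded through their `rfl`
equations in unapplied form, which keeps the kernel on B-p01's own terms). [cite: Hartshorne1977, II Ex. 5.1 (d)]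
[cite: MumfordAV1970, §10 (p. 89)] -/
theorem evalPair_baseChange (h𝓕 : HasRank 𝓕 1) : brickN X 𝓕 U h𝓕 := by
  intro B C _ _ _ _ φ σ μ
  have hH : H0map X 𝓕 U φ = fun s =>
      ((FBIso X 𝓕 U φ).hom.app ⊤) (unitSection (X ◁ specTestMap U φ).left (FB X 𝓕 U B) ⊤ s) := rfl
  have hD : DualSecMap X 𝓕 U h𝓕 φ = fun μ =>
      ((sheafHomMapLeft (FBIso X 𝓕 U φ).inv (unitModule (X ⊗ specTest U C).left)).app ⊤)
        (((pullbackDualIso (X ◁ specTestMap U φ).left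
          (HasRank.isFiniteLocallyFree' (hasRank_FB X 𝓕 U h𝓕 B))).hom.app ⊤)
            (unitSection (X ◁ specTestMap U φ).left (Modules.dual (FB X 𝓕 U B)) ⊤ μ)) := rfl
  have hEC : evalPair X 𝓕 U C = fun μ σ =>
      (appLE (μ : (FB X 𝓕 U C).over ⊤ ⟶ (unitModule (X ⊗ specTest U C).left).over ⊤) (𝟙 ⊤) σ :
        Γ(unitModule (X ⊗ specTest U C).left, (⊤ : (X ⊗ specTest U C).left.Opens))) := rfl
  have hEB : evalPair X 𝓕 U B = fun μ σ =>
      (appLE (μ : (FB X 𝓕 U B).over ⊤ ⟶ (unitModule (X ⊗ specTest U B).left).over ⊤) (𝟙 ⊤) σ :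
        Γ(unitModule (X ⊗ specTest U B).left, (⊤ : (X ⊗ specTest U B).left.Opens))) := rfl
  rw [hH, hD, hEC, hEB]
  exact appLE_sheafHomMapLeft_pullbackDualIso_unitSection (X ◁ specTestMap U φ).left
    (HasRank.isFiniteLocallyFree' (hasRank_FB X 𝓕 U h𝓕 B)) (FBIso X 𝓕 U φ) μ σ

end SeesawSubscheme

end Literature.AlgebraicGeometry.Motives

end
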